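import Summits.QuantumFields.BalabanUV.T4Continuum.Support.NE7SlicedCoarseCurlLowerBound
import Summits.QuantumFields.BalabanUV.T4Continuum.Support.NE7SliceRepFibrePoincare
import Summits.QuantumFields.BalabanUV.T4Continuum.Support.NE7FrameFreeRightInverseLetters
import Summits.QuantumFields.BalabanUV.T4Continuum.Support.NE7RightInverseFrameLetters
import Summits.QuantumFields.BalabanUV.T4Continuum.Support.NE3FrameFreeSliceW
import Summits.QuantumFields.BalabanUV.T4Continuum.Support.NE3SlicePoincareShape
import Summits.QuantumFields.BalabanUV.T4Continuum.Support.NE3TopRadiusLetters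
import HarnessLib

/-!
# NE7SliceRepHessianFloor — THE FINE WILSON HESSIAN OF A SLICE REPRESENTATIVE DOMINATES THE COARSE MAXWELL ENERGY OF ITS CONSTRAINT DIFFERENTIAL, j-UNIFORMLY (d = 4):
# for `X̃ ∈ R + T_♮(U)` (a frame-free lift `R` of the coarse datum plus row NE3's frame-free block-Landau slice, with its η-weighted slice Poincaré constant `C_P`),
# `Σ_P ‖curl_{V₀} ṽ(P)‖²_{HS∕n} ≤ ((1+θ) + 2K·4C_P·n)·hess U X̃ X̃ + 2K·(2q·A + 4C_P·B)`, `K = O(ε)`, `A, B` = the lift's mass ∕ curl letters; and for THIS LINEAGE's frame-free right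
# inverse `R₀` (✓ `NE7FrameFreeRightInverse`): `2q·A + 4C_P·B ≤ (2·liftMassC + 4C_P·liftCurlC)·Σ_b ‖ṽ_b‖²` — the remainder is `O(ε)` × the COARSE MASS of `v`, j- and N-UNIFORMLY
# (lineage `b2b-balaban-t4-ne7-p1`, gen 118, file G2; ROAD-G117 §4 (S1) «supply F9's `hff`∕`hP` on the slice»)

Cell `pub-balaban`, rung (B)+1 sub-cell t4, CRUX PROVER NE7 #1 (OWNER of row NE7), generation 118.  Inputs BY NAME: gen 117's F9 ✓ `NE7SlicedCoarseCurlLowerBound.coarse_curl_le_hess_of_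
frameFree_poincare` (the algebraic closure of (G1)+(G2) under displayed `hff`, `hP`), this gen's G1 ✓ `NE7SliceRepFibrePoincare` (two-term representative ⟹ `hff`, `hP`), row NE3's slice of
record `NE3FrameFreeSliceW.frameFreeBlockLandauW` and its Poincaré SHAPE `NE3SlicePoincareShape.SlicePoincare` (discharged on the class by row NE3-R2's ✓ `NE3ClassSlicePoincare.
classSlicePoincare_of_lines`, k-FREE constant — taken here as the displayed hypothesis `hSP`, so the file serves every slice constant), this lineage's frame-free right inverse
`NE7FrameFreeRightInverse.rightInvW0` with its letters (R1⁰) `dirSq_rightInvW0_le`, (R2⁰) `curlSq_rightInvW0_le` (gen 104) and row NE7b's frame masses (Θ₂)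
`NE7RightInverseFrameLetters.sum_normSq_framePotW_rightInvW_le` (gen 152).
WHAT ([folklore]; 0 sorry; three constant `def`s `thetaTwoC`, `liftMassC`, `liftCurlC` — explicit polynomials in the tree's named constants, not optimised):
* §1 (general `d`) **`dirSq_rightInvW0_class_le`**, **`curlSq_rightInvW0_class_le`** — the `R₀` letters in CLASS FORM under `thetaLoc·(M²x) ≤ 1∕2`, `M²x ≤ 1`:
  `dirSq (R₀φ) [0,N·M)^d ≤ (M^d∕M²)·liftMassC·dirSq φ [0,N)^d`, `curlSq W (R₀φ) [0,N·M)^d ≤ (M^d∕M⁴)·liftCurlC·dirSq φ [0,N)^d` (`M = L^{k+1}`) — in `d = 4` the SCALED fine mass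
  `M⁻²·dirSq (R₀φ)` and the fine curl energy of the lift are both `O(1)·(coarse mass)`, uniformly in `k`, `N`;
* §2 (`d = 4`) **`coarse_curl_le_hess_of_sliceRep`** — F9 with `hff`, `hP` DISCHARGED for `X̃ = R + Y`, `R` frame-free with letters `A`, `B`, `Y` frame-free with the η-weighted Poincaré
  bound of constant `C_P`; **`coarse_curl_le_hess_of_mem_slice`** — the same for `Y := X̃ − R ∈ frameFreeBlockLandauW L N (j+1) U` under the shape `hSP : SlicePoincare L (j+1) U T_♮ C_P`;
* §3 (`d = 4`) `sliceRep_args` (the four proof parameters of `R₀` at the class radius from three k-free ε-lines) and the headline **`coarse_curl_le_hess_of_mem_slice_rightInvW0`**: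
  for every class configuration `U` (radius `ε·L^{−2(j+1)}`, period `tower L N (j+1)`), every skew fine torus field `X` with `X̃ − R₀ṽ ∈ T_♮(U)` (`ṽ = (levelQ' L N j U X)̃`), every `θ > 0`:
  **`Σ_{P∈perWin N} nhsNormSq (curl V₀ ṽ P) ≤ ((1+θ) + 2K·(4C_P·n))·hess U X̃ X̃ (perWin 4 (tower L N (j+1))) + 2K·(2·liftMassC + 4C_P·liftCurlC)·dirSq ṽ (periodBox N)`**,
  `K = (1+θ)·14·#planes·ε + (1+θ⁻¹)·36·eC²·ε²`, `V₀ = cavgIter L (j+1) U` — i.e. `hess ≥ (1 − O(ε(1+C_P)))·Σ_P nhs(curl_{V₀}ṽ) − O(ε(1+C_P))·‖v‖²` ON THE SLICE, j- AND N-UNIFORMLY.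
HONEST FRAMING (page 1): composition of landed kernel theorems about OUR objects (linearised averages, row NE3's slice, this lineage's lift); the slice Poincaré constant is a displayed
hypothesis SHAPE (row NE3-R2 discharges it on the class with `CPLine`); the remaining (G′) items — the fibre∩slice reduction modulo corner-trivial gauge directions (G3 of this gen) and the
MULTIPLIER term of the bordered Hessian on a representative (row NE7b's (G3)∕(H′)) — are NOT here; no estimate of Bałaban's is asserted ([Balaban1985PropagatorsII] Thm 3.3 (3.46),
[Balaban1985Averaging] (48) p.25 are CONTEXT); NOT (G′), NOT NE7 as a spine node, NOT NE3; spine 0∕9; finite T⁴ rung (B)+1 — NOT infinite volume, NOT mass gap, NOT BetaPertH, NOT Clay.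
-/

set_option autoImplicit false

open scoped BigOperators Matrix Matrix.Norms.L2Operator
open NormedSpace Finset

namespace Summit.QuantumFields.BalabanUV.T4Continuum.NE7SliceRepHessianFloor

open Literature.MathematicalPhysics.QuantumFieldTheory.Balaban1983to89
open B7Prop1Explicit B7Prop2Explicit MatrixLog UnitaryModel
open T4AveragingDeficitWall (IsUnitaryCfg IsSkewDir SmallField Ad curl curlAt curlSq dirSq)
open T4AveragingDeficitWallBoundary (IsPeriodicCfg periodBox)
open AveragingDeficitPeriodicCounting (IsPeriodicDir)
open AveragingDeficitTorusChart (TDir chartDir isPeriodicDir_chartDir)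
open AveragingDeficitTwoLevelPrep (twoLevelSmall skewSub prop1Radius)
open AveragingDeficitMultiLevelPrep (cavgIter tower levelQ' tower_ne_zero LevelSmall TangentIter)
open MatrixNorms (nhsNormSq nhsNormSq_nonneg)
open MinimalActionLevels (perWin)
open NE3HessForm (hess)
open NE3TangentCovariantTower (framePotW dirIter)
open NE3EnergyHessContTwoTerm (dirSq_nonneg)
open NE7RadIterUniform (radD levelSmall_of_class_radius)
open NE7StraightTowerCurlEnergy (eC mC eC_nonneg)
open NE7FlatAverageCurlCommutation (isSkewDir_chartDir_id)
open NE7FrameCorrectedCurlEnergyTower (chartDir_levelQ'_eq_dirIter)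
open NE7SlicedCoarseCurlLowerBound (coarse_curl_le_hess_of_frameFree_poincare)
open NE7SliceRepFibrePoincare (fibre_poincare_nhs framePotW_eq_zero_of_add)
open NE3QbarIterCovLiftPrep (cruxC liftC liftC_nonneg)
open NE3RightInverseSolveLetters (thetaLoc l1Ball)
open NE3RightInverseL2Letter (l2C)
open NE3HatInvCurlLetters (curl2C)
open NE3RightInverseSupLetters (frameC)
open NE3FrameGenLocal (frameRad)
open NE3TopRadiusLetters (E_le_of_levelSmall)
open NE3SlicePoincareShape (SlicePoincare)
open NE3FrameFreeSliceW (frameFreeBlockLandauW)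
open NE3EnergyRateWSupOfSlicePoincare (tower_eq_mul_pow)
open NE7FrameFreeRightInverse (rightInvW0 dirIter_rightInvW0 framePotW_rightInvW0 isSkewDir_rightInvW0 isPeriodicDir_rightInvW0)
open NE7FrameFreeRightInverseLetters (dirSq_rightInvW0_le curlSq_rightInvW0_le)
open NE7RightInverseFrameLetters (sum_normSq_framePotW_rightInvW_le thetaTwoConst_nonneg)
open SpreadLift (loopRad)

noncomputable section

variable {d : ℕ} {n : Type*} [Fintype n] [DecidableEq n]

/-! ## §1 The `R₀` letters in class form (general `d`) -/

/-- `CΘ₂ = 2^d·((frameC·liftC)²·#l1Ball(frameRad))` — row NE7b's frame-mass constant of (Θ₂), named. [folklore] -/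
def thetaTwoC (d L : ℕ) : ℝ := (2 : ℝ) ^ d * ((frameC d L * liftC d) ^ 2 * ((l1Ball (frameRad d L) : Finset (Site d))).card)

/-- **THE MASS CONSTANT OF THE FRAME-FREE LIFT** (class form of (R1⁰)): `liftMassC = 8·l2C + 2·(16d³·64^{2d})·(4·CΘ₂)`. [folklore] -/
def liftMassC (d L : ℕ) : ℝ := 8 * l2C d L + 2 * (16 * (d : ℝ) ^ 3 * ((64 : ℝ) ^ d) ^ 2) * (4 * thetaTwoC d L)

/-- **THE CURL CONSTANT OF THE FRAME-FREE LIFT** (class form of (R2⁰)): `liftCurlC = 8·curl2C + 2·(16·#Plane·64^{2d})·(4·CΘ₂)`. [folklore] -/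
def liftCurlC (d L : ℕ) : ℝ := 8 * curl2C d L + 2 * (16 * (Fintype.card (T4AveragingDeficitWall.Plane d) : ℝ) * ((64 : ℝ) ^ d) ^ 2) * (4 * thetaTwoC d L)

omit [Fintype n] [DecidableEq n] in
/-- `0 ≤ thetaTwoC`. [folklore] -/
theorem thetaTwoC_nonneg (d L : ℕ) : 0 ≤ thetaTwoC d L := thetaTwoConst_nonneg d L

omit [Fintype n] [DecidableEq n] in
/-- `0 ≤ liftMassC`. [folklore] -/
theorem liftMassC_nonneg (d L : ℕ) : 0 ≤ liftMassC d L := by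
  unfold liftMassC; have := thetaTwoC_nonneg d L; have := NE3RightInverseL2Letter.l2C_nonneg d L; positivity

omit [Fintype n] [DecidableEq n] in
/-- `0 ≤ liftCurlC`. [folklore] -/
theorem liftCurlC_nonneg (d L : ℕ) : 0 ≤ liftCurlC d L := by
  unfold liftCurlC; have := thetaTwoC_nonneg d L; have := NE3HatInvCurlLetters.curl2C_nonneg d L; positivity

omit [Fintype n] [DecidableEq n] in
/-- `c∕(1 − t)² ≤ 4c` for `0 ≤ c`, `t ≤ 1∕2`. [folklore] -/
theorem div_one_sub_sq_le' {c t : ℝ} (hc : 0 ≤ c) (ht : t ≤ 1 / 2) : c / (1 - t) ^ 2 ≤ 4 * c := by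
  have h1 : 1 / 2 ≤ 1 - t := by linarith
  have h4 : 1 / 4 ≤ (1 - t) ^ 2 := by nlinarith
  rw [div_le_iff₀ (by positivity)]
  nlinarith

section Lift

variable [Nonempty n] {L : ℕ} (hL : 2 ≤ L) (k : ℕ) {W : Site d → Fin d → (Matrix n n ℂ)ˣ} {x : ℝ} (hWu : IsUnitaryCfg W) (hx : 0 ≤ x) (hs : LevelSmall d L k x)
  (hWx : SmallField W x) (N : ℕ) [NeZero N] (hθ : cruxC d L * (((L : ℝ) ^ (k + 1)) ^ 2 * x) < 1)
  (hE : 4 * (d : ℝ) ^ 2 * ((L : ℝ) ^ (k + 1) - 1) ^ 2 * x + 16 * d * loopRad d L ((prop1Radius d L)^[k] x) ≤ 1 / 2)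
  (hWP : IsPeriodicCfg W ((tower L N (k + 1) : ℕ) : ℤ)) (hθl2 : thetaLoc d L * (((L : ℝ) ^ (k + 1)) ^ 2 * x) ≤ 1 / 2) (hε : ((L : ℝ) ^ (k + 1)) ^ 2 * x ≤ 1)
  {φ : Site d → Fin d → Matrix n n ℂ} (hφ : IsSkewDir φ)

include hWP hθl2 hε in
/-- **(R1⁰) IN CLASS FORM**: `dirSq (R₀ φ) [0,N·M)^d ≤ (M^d∕M²)·liftMassC·dirSq φ [0,N)^d` (`thetaLoc·M²x ≤ 1∕2`, `M²x ≤ 1`; `d ≥ 1`). [folklore] -/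
theorem dirSq_rightInvW0_class_le (hd : 1 ≤ d) :
    dirSq (rightInvW0 hL k hWu hx hs hWx N hθ hE hφ) (periodBox (d := d) (N * L ^ (k + 1)))
      ≤ (((L : ℝ) ^ (k + 1)) ^ d / ((L : ℝ) ^ (k + 1)) ^ 2) * liftMassC d L * dirSq φ (periodBox (d := d) N) := by
  have hθl : thetaLoc d L * (((L : ℝ) ^ (k + 1)) ^ 2 * x) < 1 := hθl2.trans_lt (by norm_num)
  have hΘ := sum_normSq_framePotW_rightInvW_le hL k hWu hx hs hWx N hθ hθl hWP hφ
  have hR := dirSq_rightInvW0_le hL k hWu hx hs hWx N hθ hE hWP hθl hε hφ hd hΘ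
  set m := dirSq φ (periodBox (d := d) N) with hm
  set ρ := ((L : ℝ) ^ (k + 1)) ^ d / ((L : ℝ) ^ (k + 1)) ^ 2 with hρ
  set t := thetaLoc d L * (((L : ℝ) ^ (k + 1)) ^ 2 * x) with ht
  have hm0 : 0 ≤ m := dirSq_nonneg _ _
  have hρ0 : 0 ≤ ρ := by positivity
  have h1 : l2C d L / (1 - t) ^ 2 ≤ 4 * l2C d L := div_one_sub_sq_le' (NE3RightInverseL2Letter.l2C_nonneg d L) hθl2
  have h2 : thetaTwoC d L / (1 - t) ^ 2 ≤ 4 * thetaTwoC d L := div_one_sub_sq_le' (thetaTwoC_nonneg d L) hθl2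
  have hA : 2 * (l2C d L / (1 - t) ^ 2 * ρ * m) ≤ 8 * l2C d L * (ρ * m) := by nlinarith [mul_nonneg hρ0 hm0]
  have hB : 2 * (16 * (d : ℝ) ^ 3 * ((64 : ℝ) ^ d) ^ 2 * ρ * (thetaTwoC d L / (1 - t) ^ 2 * m))
      ≤ 2 * (16 * (d : ℝ) ^ 3 * ((64 : ℝ) ^ d) ^ 2) * (4 * thetaTwoC d L) * (ρ * m) := by
    have hc : 0 ≤ 2 * (16 * (d : ℝ) ^ 3 * ((64 : ℝ) ^ d) ^ 2) * ρ := by positivity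
    nlinarith [mul_le_mul_of_nonneg_left (mul_le_mul_of_nonneg_right h2 hm0) hc]
  calc dirSq (rightInvW0 hL k hWu hx hs hWx N hθ hE hφ) (periodBox (d := d) (N * L ^ (k + 1)))
      ≤ 2 * (l2C d L / (1 - t) ^ 2 * ρ * m) + 2 * (16 * (d : ℝ) ^ 3 * ((64 : ℝ) ^ d) ^ 2 * ρ * (thetaTwoC d L / (1 - t) ^ 2 * m)) := hR
    _ ≤ 8 * l2C d L * (ρ * m) + 2 * (16 * (d : ℝ) ^ 3 * ((64 : ℝ) ^ d) ^ 2) * (4 * thetaTwoC d L) * (ρ * m) := add_le_add hA hB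
    _ = ρ * liftMassC d L * m := by unfold liftMassC; ring

include hWP hθl2 hε in
/-- **(R2⁰) IN CLASS FORM**: `curlSq W (R₀ φ) [0,N·M)^d ≤ (M^d∕M⁴)·liftCurlC·dirSq φ [0,N)^d` (`thetaLoc·M²x ≤ 1∕2`, `M²x ≤ 1`). [folklore] -/
theorem curlSq_rightInvW0_class_le :
    curlSq W (rightInvW0 hL k hWu hx hs hWx N hθ hE hφ) (periodBox (d := d) (N * L ^ (k + 1)))
      ≤ (((L : ℝ) ^ (k + 1)) ^ d / ((L : ℝ) ^ (k + 1)) ^ 4) * liftCurlC d L * dirSq φ (periodBox (d := d) N) := by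
  have hθl : thetaLoc d L * (((L : ℝ) ^ (k + 1)) ^ 2 * x) < 1 := hθl2.trans_lt (by norm_num)
  have hΘ := sum_normSq_framePotW_rightInvW_le hL k hWu hx hs hWx N hθ hθl hWP hφ
  have hR := curlSq_rightInvW0_le hL k hWu hx hs hWx N hθ hE hWP hθl hε hφ hΘ
  set m := dirSq φ (periodBox (d := d) N) with hm
  set ρ := ((L : ℝ) ^ (k + 1)) ^ d / ((L : ℝ) ^ (k + 1)) ^ 4 with hρ
  set t := thetaLoc d L * (((L : ℝ) ^ (k + 1)) ^ 2 * x) with ht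
  set s := ((L : ℝ) ^ (k + 1)) ^ 2 * x with hsx
  have hm0 : 0 ≤ m := dirSq_nonneg _ _
  have hρ0 : 0 ≤ ρ := by positivity
  have hs0 : 0 ≤ s := by positivity
  have hs1 : s ^ 2 ≤ 1 := by nlinarith
  have h1 : curl2C d L / (1 - t) ^ 2 ≤ 4 * curl2C d L := div_one_sub_sq_le' (NE3HatInvCurlLetters.curl2C_nonneg d L) hθl2
  have h2 : thetaTwoC d L / (1 - t) ^ 2 ≤ 4 * thetaTwoC d L := div_one_sub_sq_le' (thetaTwoC_nonneg d L) hθl2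
  have hA : 2 * (curl2C d L / (1 - t) ^ 2 * ρ * m) ≤ 8 * curl2C d L * (ρ * m) := by nlinarith [mul_nonneg hρ0 hm0]
  have hB : 2 * (16 * (Fintype.card (T4AveragingDeficitWall.Plane d) : ℝ) * ((64 : ℝ) ^ d) ^ 2 * s ^ 2 * ρ * (thetaTwoC d L / (1 - t) ^ 2 * m))
      ≤ 2 * (16 * (Fintype.card (T4AveragingDeficitWall.Plane d) : ℝ) * ((64 : ℝ) ^ d) ^ 2) * (4 * thetaTwoC d L) * (ρ * m) := by
    have hc : 0 ≤ 2 * (16 * (Fintype.card (T4AveragingDeficitWall.Plane d) : ℝ) * ((64 : ℝ) ^ d) ^ 2) * ρ := by positivity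
    have h3 : thetaTwoC d L / (1 - t) ^ 2 * m ≤ 4 * thetaTwoC d L * m := mul_le_mul_of_nonneg_right h2 hm0
    have h4 : 0 ≤ thetaTwoC d L / (1 - t) ^ 2 * m := mul_nonneg (div_nonneg (thetaTwoC_nonneg d L) (sq_nonneg _)) hm0
    have h5 : s ^ 2 * (thetaTwoC d L / (1 - t) ^ 2 * m) ≤ 1 * (4 * thetaTwoC d L * m) :=
      mul_le_mul hs1 h3 h4 (by norm_num)
    nlinarith [mul_le_mul_of_nonneg_left h5 hc]
  calc curlSq W (rightInvW0 hL k hWu hx hs hWx N hθ hE hφ) (periodBox (d := d) (N * L ^ (k + 1)))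
      ≤ 2 * (curl2C d L / (1 - t) ^ 2 * ρ * m)
        + 2 * (16 * (Fintype.card (T4AveragingDeficitWall.Plane d) : ℝ) * ((64 : ℝ) ^ d) ^ 2 * s ^ 2 * ρ * (thetaTwoC d L / (1 - t) ^ 2 * m)) := hR
    _ ≤ 8 * curl2C d L * (ρ * m) + 2 * (16 * (Fintype.card (T4AveragingDeficitWall.Plane d) : ℝ) * ((64 : ℝ) ^ d) ^ 2) * (4 * thetaTwoC d L) * (ρ * m) :=
        add_le_add hA hB
    _ = ρ * liftCurlC d L * m := by unfold liftCurlC; ring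

end Lift

/-! ## §2 F9 with `hff`, `hP` discharged for a two-term slice representative (`d = 4`) -/

/-- `((L^{j+1})⁻¹)² = (L⁻¹)^{2(j+1)}`. [folklore] -/
theorem inv_pow_sq_eq (L : ℝ) (j : ℕ) : ((L ^ (j + 1))⁻¹) ^ 2 = (L⁻¹) ^ (2 * (j + 1)) := by
  rw [← inv_pow, ← pow_mul, mul_comm]

/-- **F9 ON A TWO-TERM SLICE REPRESENTATIVE** (`d = 4`, j-UNIFORM): hypotheses of ✓ `coarse_curl_le_hess_of_frameFree_poincare` on `(L, N, ε, j, U, X)`, a FRAME-FREE field `R` with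
`dirSq R (periodBox P) ≤ A`, `curlSq U R (periodBox P) ≤ B` (`P = tower L N (j+1)`), such that `Y := X̃ − R` is FRAME-FREE and obeys the η-weighted Poincaré bound
`(L⁻¹)^{2(j+1)}·dirSq Y (periodBox P) ≤ C_P·curlSq U Y (periodBox P)` (`0 ≤ C_P`), and the absorption line `28·#planes·ε·(4·C_P·card n) ≤ 1`; then for every `θ > 0`, with
`K := (1+θ)·14·#planes·ε + (1+θ⁻¹)·36·eC²·ε²`:
`Σ_{P∈perWin N} nhsNormSq (curl V₀ ṽ P) ≤ ((1+θ) + 2K·(4C_P·card n))·hess U X̃ X̃ (perWin 4 P) + 2K·(2·(L⁻¹)^{2(j+1)}·A + 4·C_P·B)`. [folklore] -/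
theorem coarse_curl_le_hess_of_sliceRep [Nonempty n] {L N : ℕ} [NeZero L] [NeZero N] (hL : 2 ≤ L) (hN : 1 ≤ N) {ε : ℝ} (hε : 0 ≤ ε)
    (hεD : 4 * ε * radD 4 L * (((L : ℝ) ^ 2)⁻¹) ^ 2 ≤ 1) (hεT : twoLevelSmall 4 L * (2 * ε * ((L : ℝ) ^ 2)⁻¹) ≤ 1)
    (hεM : 8 * (L : ℝ) * mC 4 L (Fintype.card n) * ε * ((L : ℝ) ^ 2)⁻¹ ≤ 1) (j : ℕ)
    {U : Site 4 → Fin 4 → (Matrix n n ℂ)ˣ} (hU : IsUnitaryCfg U) (hUP : IsPeriodicCfg U ((tower L N (j + 1) : ℕ) : ℤ))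
    (hUx : SmallField U (ε * (((L : ℝ) ^ 2)⁻¹) ^ (j + 1)))
    {X : TDir 4 n (L * tower L N j)} (hX : X ∈ skewSub 4 n (L * tower L N j))
    {R : Site 4 → Fin 4 → Matrix n n ℂ} (hRff : ∀ z : Site 4, framePotW L (j + 1) U R z = 0) {A B CP : ℝ} (hCP : 0 ≤ CP)
    (hRA : dirSq R (periodBox (tower L N (j + 1))) ≤ A) (hRB : curlSq U R (periodBox (tower L N (j + 1))) ≤ B)
    (hYff : ∀ z : Site 4, framePotW L (j + 1) U (fun y ν => chartDir (ContinuousLinearMap.id ℝ (Matrix n n ℂ)) (L * tower L N j) X y ν - R y ν) z = 0)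
    (hYP : ((L : ℝ)⁻¹) ^ (2 * (j + 1)) * dirSq (fun y ν => chartDir (ContinuousLinearMap.id ℝ (Matrix n n ℂ)) (L * tower L N j) X y ν - R y ν) (periodBox (tower L N (j + 1)))
      ≤ CP * curlSq U (fun y ν => chartDir (ContinuousLinearMap.id ℝ (Matrix n n ℂ)) (L * tower L N j) X y ν - R y ν) (periodBox (tower L N (j + 1))))
    (habs : 28 * (Fintype.card (T4AveragingDeficitWall.Plane 4) : ℝ) * ε * (4 * CP * Fintype.card n) ≤ 1) {θ : ℝ} (hθ : 0 < θ) :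
    ∑ P ∈ perWin 4 N, nhsNormSq
        (curl (cavgIter L (j + 1) U) (chartDir (ContinuousLinearMap.id ℝ (Matrix n n ℂ)) N ((levelQ' L N j U X : ↥(skewSub 4 n N)) : TDir 4 n N)) P)
      ≤ ((1 + θ) + 2 * ((1 + θ) * (14 * (Fintype.card (T4AveragingDeficitWall.Plane 4) : ℝ) * ε) + (1 + θ⁻¹) * (36 * eC 4 L (Fintype.card n) ^ 2 * ε ^ 2))
            * (4 * CP * Fintype.card n))
          * hess U (chartDir (ContinuousLinearMap.id ℝ (Matrix n n ℂ)) (L * tower L N j) X) (chartDir (ContinuousLinearMap.id ℝ (Matrix n n ℂ)) (L * tower L N j) X)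
              (perWin 4 (tower L N (j + 1)))
        + 2 * ((1 + θ) * (14 * (Fintype.card (T4AveragingDeficitWall.Plane 4) : ℝ) * ε) + (1 + θ⁻¹) * (36 * eC 4 L (Fintype.card n) ^ 2 * ε ^ 2))
            * (2 * ((L : ℝ)⁻¹) ^ (2 * (j + 1)) * A + 4 * CP * B) := by
  have hL1 : 1 ≤ L := by omega
  obtain ⟨hs, -⟩ := levelSmall_of_class_radius (d := 4) hL hε hεD hεT j
  have hx : 0 ≤ ε * (((L : ℝ) ^ 2)⁻¹) ^ (j + 1) := by positivity
  set Xt := chartDir (ContinuousLinearMap.id ℝ (Matrix n n ℂ)) (L * tower L N j) X with hXt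
  -- the two-term decomposition `X̃ = R + Y`
  have hdec : ∀ (y : Site 4) (ν : Fin 4), Xt y ν = R y ν + (fun y' ν' => Xt y' ν' - R y' ν') y ν := fun y ν => by simp only [add_sub_cancel]
  -- hff
  have hff : ∀ z : Site 4, framePotW L (j + 1) U Xt z = 0 :=
    framePotW_eq_zero_of_add hL1 j hU hx hs hUx hdec hRff hYff
  -- hP
  have hq : 0 ≤ ((L : ℝ)⁻¹) ^ (2 * (j + 1)) := by positivity
  have hP := fibre_poincare_nhs (W := U) hq hCP (tower L N (j + 1)) hdec hYP hRA hRB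
  have hCP' : 0 ≤ 4 * CP * Fintype.card n := by positivity
  exact coarse_curl_le_hess_of_frameFree_poincare hL hN hε hεD hεT hεM j hU hUP hUx hX hff hCP' hP habs hθ

/-- **F9 ON ROW NE3's SLICE OF RECORD** (`d = 4`, j-UNIFORM): as above, with `Y := X̃ − R ∈ frameFreeBlockLandauW L N (j+1) U` and the η-weighted slice Poincaré SHAPE
`hSP : SlicePoincare L (j+1) U (frameFreeBlockLandauW L N (j+1) U) C_P (periodBox (N·L^{j+1}))` (row NE3-R2's ✓ `classSlicePoincare_of_lines` supplies it on the class with `CPLine`). [folklore] -/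
theorem coarse_curl_le_hess_of_mem_slice [Nonempty n] {L N : ℕ} [NeZero L] [NeZero N] (hL : 2 ≤ L) (hN : 1 ≤ N) {ε : ℝ} (hε : 0 ≤ ε)
    (hεD : 4 * ε * radD 4 L * (((L : ℝ) ^ 2)⁻¹) ^ 2 ≤ 1) (hεT : twoLevelSmall 4 L * (2 * ε * ((L : ℝ) ^ 2)⁻¹) ≤ 1)
    (hεM : 8 * (L : ℝ) * mC 4 L (Fintype.card n) * ε * ((L : ℝ) ^ 2)⁻¹ ≤ 1) (j : ℕ)
    {U : Site 4 → Fin 4 → (Matrix n n ℂ)ˣ} (hU : IsUnitaryCfg U) (hUP : IsPeriodicCfg U ((tower L N (j + 1) : ℕ) : ℤ))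
    (hUx : SmallField U (ε * (((L : ℝ) ^ 2)⁻¹) ^ (j + 1)))
    {X : TDir 4 n (L * tower L N j)} (hX : X ∈ skewSub 4 n (L * tower L N j))
    {R : Site 4 → Fin 4 → Matrix n n ℂ} (hRff : ∀ z : Site 4, framePotW L (j + 1) U R z = 0) {A B CP : ℝ} (hCP : 0 ≤ CP)
    (hRA : dirSq R (periodBox (tower L N (j + 1))) ≤ A) (hRB : curlSq U R (periodBox (tower L N (j + 1))) ≤ B)
    (hY : (fun y ν => chartDir (ContinuousLinearMap.id ℝ (Matrix n n ℂ)) (L * tower L N j) X y ν - R y ν) ∈ frameFreeBlockLandauW (d := 4) (n := n) L N (j + 1) U)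
    (hSP : SlicePoincare L (j + 1) U (frameFreeBlockLandauW (d := 4) (n := n) L N (j + 1) U) CP (periodBox (N * L ^ (j + 1))))
    (habs : 28 * (Fintype.card (T4AveragingDeficitWall.Plane 4) : ℝ) * ε * (4 * CP * Fintype.card n) ≤ 1) {θ : ℝ} (hθ : 0 < θ) :
    ∑ P ∈ perWin 4 N, nhsNormSq
        (curl (cavgIter L (j + 1) U) (chartDir (ContinuousLinearMap.id ℝ (Matrix n n ℂ)) N ((levelQ' L N j U X : ↥(skewSub 4 n N)) : TDir 4 n N)) P)
      ≤ ((1 + θ) + 2 * ((1 + θ) * (14 * (Fintype.card (T4AveragingDeficitWall.Plane 4) : ℝ) * ε) + (1 + θ⁻¹) * (36 * eC 4 L (Fintype.card n) ^ 2 * ε ^ 2))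
            * (4 * CP * Fintype.card n))
          * hess U (chartDir (ContinuousLinearMap.id ℝ (Matrix n n ℂ)) (L * tower L N j) X) (chartDir (ContinuousLinearMap.id ℝ (Matrix n n ℂ)) (L * tower L N j) X)
              (perWin 4 (tower L N (j + 1)))
        + 2 * ((1 + θ) * (14 * (Fintype.card (T4AveragingDeficitWall.Plane 4) : ℝ) * ε) + (1 + θ⁻¹) * (36 * eC 4 L (Fintype.card n) ^ 2 * ε ^ 2))
            * (2 * ((L : ℝ)⁻¹) ^ (2 * (j + 1)) * A + 4 * CP * B) := by
  have hYff : ∀ z : Site 4, framePotW L (j + 1) U (fun y ν => chartDir (ContinuousLinearMap.id ℝ (Matrix n n ℂ)) (L * tower L N j) X y ν - R y ν) z = 0 := hY.2.2.2.1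
  have hP0 := hSP _ hY
  rw [← tower_eq_mul_pow, inv_pow_sq_eq] at hP0
  exact coarse_curl_le_hess_of_sliceRep hL hN hε hεD hεT hεM j hU hUP hUx hX hRff hCP hRA hRB hYff hP0 habs hθ

/-! ## §3 The headline: the slice of record through this lineage's frame-free right inverse `R₀` (`d = 4`) -/

/-- `(L^{j+1})²·(ε·(L²)⁻¹^{j+1}) = ε`. [folklore] -/
theorem sq_mul_classRadius_eq {L : ℕ} (hL : 1 ≤ L) (ε : ℝ) (j : ℕ) :
    ((L : ℝ) ^ (j + 1)) ^ 2 * (ε * (((L : ℝ) ^ 2)⁻¹) ^ (j + 1)) = ε := by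
  have hL0 : (L : ℝ) ≠ 0 := by exact_mod_cast (show L ≠ 0 by omega)
  rw [inv_pow, ← pow_mul, ← pow_mul, mul_comm 2 (j + 1)]
  field_simp

/-- **THE FOUR PROOF PARAMETERS OF `R₀` AT THE CLASS RADIUS FROM k-FREE ε-LINES** (`d = 4`, `L ≥ 2`): `0 ≤ x`, `LevelSmall 4 L j x`, `cruxC·(M²x) < 1`, and the def-parameter line
`4d²(M−1)²x + 16d·loopRad(prop1Radius^[j] x) ≤ 1∕2`, for `x = ε·L^{−2(j+1)}`, from `hεD`, `hεT`, `cruxC·ε < 1`, `43584·ε ≤ 1∕2`. [folklore] -/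
theorem sliceRep_args {L : ℕ} (hL : 2 ≤ L) {ε : ℝ} (hε : 0 ≤ ε) (hεD : 4 * ε * radD 4 L * (((L : ℝ) ^ 2)⁻¹) ^ 2 ≤ 1)
    (hεT : twoLevelSmall 4 L * (2 * ε * ((L : ℝ) ^ 2)⁻¹) ≤ 1) (hcrux : cruxC 4 L * ε < 1) (hEl : 43584 * ε ≤ 1 / 2) (j : ℕ) :
    0 ≤ ε * (((L : ℝ) ^ 2)⁻¹) ^ (j + 1) ∧ LevelSmall 4 L j (ε * (((L : ℝ) ^ 2)⁻¹) ^ (j + 1))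
      ∧ cruxC 4 L * (((L : ℝ) ^ (j + 1)) ^ 2 * (ε * (((L : ℝ) ^ 2)⁻¹) ^ (j + 1))) < 1
      ∧ 4 * ((4 : ℕ) : ℝ) ^ 2 * ((L : ℝ) ^ (j + 1) - 1) ^ 2 * (ε * (((L : ℝ) ^ 2)⁻¹) ^ (j + 1))
          + 16 * ((4 : ℕ) : ℝ) * loopRad 4 L ((prop1Radius 4 L)^[j] (ε * (((L : ℝ) ^ 2)⁻¹) ^ (j + 1))) ≤ 1 / 2 := by
  have hL1 : 1 ≤ L := by omega
  obtain ⟨hs, -⟩ := levelSmall_of_class_radius (d := 4) hL hε hεD hεT j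
  have hx : 0 ≤ ε * (((L : ℝ) ^ 2)⁻¹) ^ (j + 1) := by positivity
  have hMx := sq_mul_classRadius_eq hL1 ε j
  refine ⟨hx, hs, by rw [hMx]; exact hcrux, ?_⟩
  have hE0 := E_le_of_levelSmall (d := 4) hL j hx hs
  rw [hMx] at hE0
  refine hE0.trans ?_
  have : (4 * ((4 : ℕ) : ℝ) ^ 2 + 272 * ((4 : ℕ) : ℝ) * ((((4 : ℕ) : ℝ) + 1) * (((4 : ℕ) : ℝ) + 4))) * ε = 43584 * ε := by norm_num
  rw [this]; exact hEl

/-- **THE FINE WILSON HESSIAN OF THE SLICE REPRESENTATIVE DOMINATES THE COARSE MAXWELL ENERGY OF ITS CONSTRAINT DIFFERENTIAL** (`d = 4`, every `U(n)`, `L ≥ 2`, j- AND N-UNIFORM):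
class configuration `U` (unitary, `(tower L N (j+1))`-periodic, `SmallField U (ε·L^{−2(j+1)})`), k-free ε-lines (`hεD`, `hεT`, `hεM` of F7, `cruxC·ε < 1`, `thetaLoc·ε ≤ 1∕2`,
`ε ≤ 1`, `43584·ε ≤ 1∕2`, the absorption line `28·#planes·ε·(4C_P·card n) ≤ 1`), a skew fine torus field `X` with `ṽ := (levelQ' L N j U X)̃` and the SLICE CONDITION
`X̃ − R₀ ṽ ∈ frameFreeBlockLandauW L N (j+1) U` (`R₀ = rightInvW0` at the class radius, its four proof parameters displayed — `sliceRep_args` supplies them), the slice Poincaré SHAPE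
`hSP` with constant `C_P`; then for every `θ > 0`, `K := (1+θ)·14·#planes·ε + (1+θ⁻¹)·36·eC²·ε²`:
**`Σ_{P∈perWin N} nhsNormSq (curl V₀ ṽ P) ≤ ((1+θ) + 2K·(4C_P·card n))·hess U X̃ X̃ (perWin 4 (tower L N (j+1))) + 2K·(2·liftMassC 4 L + 4·C_P·liftCurlC 4 L)·dirSq ṽ (periodBox N)`**.
[cite: Balaban1985Averaging, (48) p.25; Balaban1985PropagatorsII, Thm 3.3 (3.46)] -/
theorem coarse_curl_le_hess_of_mem_slice_rightInvW0 [Nonempty n] {L N : ℕ} [NeZero L] [NeZero N] (hL : 2 ≤ L) (hN : 1 ≤ N) {ε : ℝ} (hε : 0 ≤ ε)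
    (hεD : 4 * ε * radD 4 L * (((L : ℝ) ^ 2)⁻¹) ^ 2 ≤ 1) (hεT : twoLevelSmall 4 L * (2 * ε * ((L : ℝ) ^ 2)⁻¹) ≤ 1)
    (hεM : 8 * (L : ℝ) * mC 4 L (Fintype.card n) * ε * ((L : ℝ) ^ 2)⁻¹ ≤ 1) (hε1 : ε ≤ 1) (hθl2 : thetaLoc 4 L * ε ≤ 1 / 2) (j : ℕ)
    {U : Site 4 → Fin 4 → (Matrix n n ℂ)ˣ} (hU : IsUnitaryCfg U) (hUP : IsPeriodicCfg U ((tower L N (j + 1) : ℕ) : ℤ))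
    (hUx : SmallField U (ε * (((L : ℝ) ^ 2)⁻¹) ^ (j + 1)))
    (hx : 0 ≤ ε * (((L : ℝ) ^ 2)⁻¹) ^ (j + 1)) (hs : LevelSmall 4 L j (ε * (((L : ℝ) ^ 2)⁻¹) ^ (j + 1)))
    (hcr : cruxC 4 L * (((L : ℝ) ^ (j + 1)) ^ 2 * (ε * (((L : ℝ) ^ 2)⁻¹) ^ (j + 1))) < 1)
    (hE : 4 * ((4 : ℕ) : ℝ) ^ 2 * ((L : ℝ) ^ (j + 1) - 1) ^ 2 * (ε * (((L : ℝ) ^ 2)⁻¹) ^ (j + 1))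
          + 16 * ((4 : ℕ) : ℝ) * loopRad 4 L ((prop1Radius 4 L)^[j] (ε * (((L : ℝ) ^ 2)⁻¹) ^ (j + 1))) ≤ 1 / 2)
    {X : TDir 4 n (L * tower L N j)} (hX : X ∈ skewSub 4 n (L * tower L N j))
    (hvs : IsSkewDir (chartDir (ContinuousLinearMap.id ℝ (Matrix n n ℂ)) N ((levelQ' L N j U X : ↥(skewSub 4 n N)) : TDir 4 n N)))
    (hslice : (fun y ν => chartDir (ContinuousLinearMap.id ℝ (Matrix n n ℂ)) (L * tower L N j) X y ν - rightInvW0 hL j hU hx hs hUx N hcr hE hvs y ν)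
      ∈ frameFreeBlockLandauW (d := 4) (n := n) L N (j + 1) U)
    {CP : ℝ} (hCP : 0 ≤ CP) (hSP : SlicePoincare L (j + 1) U (frameFreeBlockLandauW (d := 4) (n := n) L N (j + 1) U) CP (periodBox (N * L ^ (j + 1))))
    (habs : 28 * (Fintype.card (T4AveragingDeficitWall.Plane 4) : ℝ) * ε * (4 * CP * Fintype.card n) ≤ 1) {θ : ℝ} (hθ : 0 < θ) :
    ∑ P ∈ perWin 4 N, nhsNormSq
        (curl (cavgIter L (j + 1) U) (chartDir (ContinuousLinearMap.id ℝ (Matrix n n ℂ)) N ((levelQ' L N j U X : ↥(skewSub 4 n N)) : TDir 4 n N)) P)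
      ≤ ((1 + θ) + 2 * ((1 + θ) * (14 * (Fintype.card (T4AveragingDeficitWall.Plane 4) : ℝ) * ε) + (1 + θ⁻¹) * (36 * eC 4 L (Fintype.card n) ^ 2 * ε ^ 2))
            * (4 * CP * Fintype.card n))
          * hess U (chartDir (ContinuousLinearMap.id ℝ (Matrix n n ℂ)) (L * tower L N j) X) (chartDir (ContinuousLinearMap.id ℝ (Matrix n n ℂ)) (L * tower L N j) X)
              (perWin 4 (tower L N (j + 1)))
        + 2 * ((1 + θ) * (14 * (Fintype.card (T4AveragingDeficitWall.Plane 4) : ℝ) * ε) + (1 + θ⁻¹) * (36 * eC 4 L (Fintype.card n) ^ 2 * ε ^ 2))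
            * ((2 * liftMassC 4 L + 4 * CP * liftCurlC 4 L)
                * dirSq (chartDir (ContinuousLinearMap.id ℝ (Matrix n n ℂ)) N ((levelQ' L N j U X : ↥(skewSub 4 n N)) : TDir 4 n N)) (periodBox N)) := by
  have hL1 : 1 ≤ L := by omega
  have hMx := sq_mul_classRadius_eq hL1 ε j
  set vt := chartDir (ContinuousLinearMap.id ℝ (Matrix n n ℂ)) N ((levelQ' L N j U X : ↥(skewSub 4 n N)) : TDir 4 n N) with hvt
  set R := rightInvW0 hL j hU hx hs hUx N hcr hE hvs with hRdef
  have hθl2' : thetaLoc 4 L * (((L : ℝ) ^ (j + 1)) ^ 2 * (ε * (((L : ℝ) ^ 2)⁻¹) ^ (j + 1))) ≤ 1 / 2 := by rw [hMx]; exact hθl2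
  have hε1' : ((L : ℝ) ^ (j + 1)) ^ 2 * (ε * (((L : ℝ) ^ 2)⁻¹) ^ (j + 1)) ≤ 1 := by rw [hMx]; exact hε1
  -- the lift is frame-free, with class letters
  have hRff : ∀ z : Site 4, framePotW L (j + 1) U R z = 0 := fun z => framePotW_rightInvW0 hL j hU hx hs hUx N hcr hE hvs hUP ⟨0, by omega⟩ z
  have hRA0 := dirSq_rightInvW0_class_le hL j hU hx hs hUx N hcr hE hUP hθl2' hε1' hvs (by norm_num)
  have hRB0 := curlSq_rightInvW0_class_le hL j hU hx hs hUx N hcr hE hUP hθl2' hε1' hvs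
  rw [← tower_eq_mul_pow] at hRA0 hRB0
  set m := dirSq vt (periodBox (d := 4) N) with hm
  have hm0 : 0 ≤ m := dirSq_nonneg _ _
  -- in `d = 4`: `M⁴∕M² = M²`, `M⁴∕M⁴ = 1`
  have hL0 : (0 : ℝ) < L := by exact_mod_cast (show 0 < L by omega)
  have hM0 : (0 : ℝ) < (L : ℝ) ^ (j + 1) := by positivity
  have e42 : ((L : ℝ) ^ (j + 1)) ^ 4 / ((L : ℝ) ^ (j + 1)) ^ 2 = ((L : ℝ) ^ (j + 1)) ^ 2 := by
    rw [div_eq_iff (by positivity)]; ring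
  have e44 : ((L : ℝ) ^ (j + 1)) ^ 4 / ((L : ℝ) ^ (j + 1)) ^ 4 = 1 := div_self (by positivity)
  rw [e42] at hRA0
  rw [e44, one_mul] at hRB0
  have h := coarse_curl_le_hess_of_mem_slice hL hN hε hεD hεT hεM j hU hUP hUx hX hRff hCP hRA0 hRB0 hslice hSP habs hθ
  -- `q·(M²·c·m) = c·m`
  have hq : ((L : ℝ)⁻¹) ^ (2 * (j + 1)) * ((L : ℝ) ^ (j + 1)) ^ 2 = 1 := by
    rw [← inv_pow_sq_eq, ← mul_pow, inv_mul_cancel₀ hM0.ne', one_pow]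
  have e : 2 * ((L : ℝ)⁻¹) ^ (2 * (j + 1)) * (((L : ℝ) ^ (j + 1)) ^ 2 * liftMassC 4 L * m) + 4 * CP * (liftCurlC 4 L * m)
      = (2 * liftMassC 4 L + 4 * CP * liftCurlC 4 L) * m := by
    calc 2 * ((L : ℝ)⁻¹) ^ (2 * (j + 1)) * (((L : ℝ) ^ (j + 1)) ^ 2 * liftMassC 4 L * m) + 4 * CP * (liftCurlC 4 L * m)
        = (2 * (((L : ℝ)⁻¹) ^ (2 * (j + 1)) * ((L : ℝ) ^ (j + 1)) ^ 2) * liftMassC 4 L + 4 * CP * liftCurlC 4 L) * m := by ring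
      _ = _ := by rw [hq, mul_one]
  rw [e] at h
  exact h

end

end Summit.QuantumFields.BalabanUV.T4Continuum.NE7SliceRepHessianFloor
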